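import Literature.Barriers.ValiantsHypothesis.BIJL18TPhiSafeProofs
import HarnessLib

/-!
# Bläser–Ikenmeyer–Jindal–Lysikov 2018, Lemma 22 (2) — REPAIRED: the bounded-occurrence gap
`CR(T_φ) ≥ (5 + ε/c) · s` (`BIJL2018_lemma22_gap`)

Sibling proofs file of `BIJL18MatrixCompletion.lean` (val-lit row BIJL2018-A), continuing
`BIJL18TPhiCompletionRankProofs.lean` (val-lit p2: the printed Lemma 22 (2) is FALSE for general
3-CNF, `not_BIJL2018_lemma22`, because `CR(T_φ) ≤ 5s + t`), `BIJL18TPhiRankCore.lean` and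
`BIJL18TPhiSafeProofs.lean` (val-lit t23: the exact reduction `CR(T_φ) ≤ 5s ⇔ φ` satisfiable).

**The repair.** Let every variable of `φ` occur in at most `c ≥ 1` clauses — the promise that the
source problem of BIJL Thm. 20 ([ACG⁺99, Thm. 8.13], 3-CNF with bounded occurrences) supplies.  Then

* `Lemma22Gap.length_le_numSat₃_add` — at EVERY point of the pencil of `T_φ`, the Boolean rounding
  `σ(v) := [c_v = 1]` satisfies at least `s − c · (rk − 5s)` clauses;
* `exists_length_le_numSat₃_add_completionRank` — hence `max_σ numSat₃ φ σ ≥ s − c · (CR(T_φ) − 5s)`;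
* `BIJL2018_lemma22_gap` (= `Lemma22Gap.completionRank_tphi_gap`) — **if every Boolean assignment
  satisfies at most `(1 − ε) s` clauses then `CR(T_φ) ≥ (5 + ε/c) · s`.**

So the printed `ε` must be read `ε/c`; with that reading BIJL's route to Thm. 23 (Lemma 22 +
Thm. 18: `R(T_φ) = CR(T_φ) + k`, `k = Θ(s)` slices) gives a constant-factor gap again.  The bound
is tight on the refuting example of `not_BIJL2018_lemma22` (`t = 1`, `s = 4`, `c = 4`, `ε = 1/2`:
`20.5 ≤ CR ≤ 21`).

**Proof.** Fix a point; let `P` be the pencil, `V` its column space, `rk P = 5s + ρ`.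
(i) `Lemma22Gap.gap_core`: the `5s` columns `(j, varRow 0/1/2)`, `(j, clauseRow 2/1)` are
independent (unitriangular minor, `tphiCore_five_mul_le_rank`) and supported on their own block;
extend them to a basis of `V` BY COLUMNS (`exists_linearIndepOn_id_extension`); every column of `P`
is supported on at most `c` blocks (a local column `(j′, varCol a′)` of a variable `x` meets only the
blocks of clauses containing `x` — `Lemma22Gap.pencil_varRow_varCol_eq_zero_of_forall_ne`; every
other column lives in one block — `Lemma22Safe.pencil_offblock`), so the set `J` of blocks met by the
`ρ` added columns has `|J| ≤ cρ`, and for `j ∉ J` every column's block-`j` segment lies in the span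
of the five selected segments of block `j`.  (ii) `Lemma22Gap.tphiCore_local`: that LOCAL hypothesis
already forces `u = x, v = y, w = z` and `(1−ℓ(u))(1−ℓ(v))(1−ℓ(w)) = 0` in block `j` (the per-block
computation of t23's `tphiCore_of_rank_le`), i.e. a literal of clause `j` is satisfied by the actual
value of its variable (`Lemma21.satisfiesLit_of_sub_gl_eq_zero`).  (iii) Round.

Theorem-only file; no new facts.  HONEST FRAMING: an erratum-with-repair for a gadget lemma inside
an NP-hardness proof; `VP ≠ VNP` is NOT proved and nothing here is progress on it.

## References
* [BlaserIkenmeyerJindalLysikov2018] M. Bläser, C. Ikenmeyer, G. Jindal, V. Lysikov, STOC 2018 /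
  ECCC TR18-064, §5: Thm. 20 (bounded-occurrence source problem), Lemma 22 and its printed proof
  (p. 16), Thm. 23.
-/

noncomputable section

namespace Literature.Barriers.ValiantsHypothesis

open Literature.Computability.AlgebraicComplexity Matrix

universe u

variable {K : Type u} [Field K]

namespace Lemma22Gap

/-- **The gap core (linear algebra).** Let `M` be a square matrix on `Fin s × Fin 9`, with five
selected columns `(j, cvec k)` and five selected rows `(j, rvec k)` per block such that the
`5s × 5s` minor on them is nonsingular and the selected columns of block `j` are supported on the
rows of block `j`; suppose every column `q` is supported on the rows of at most `c` blocks
(`touch q`). Then there is a set `J` of at most `c · (rk M − 5s)` blocks such that for every block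
`j ∉ J`, the block-`j` segment of EVERY column lies in the span of the block-`j` segments of the five
selected columns of block `j`. (Extend the `5s` selected columns to a basis of the column space by
columns; `J` = the blocks met by the added columns.)
[cite: BlaserIkenmeyerJindalLysikov2018, Lemma 22 (2) (repaired form, proof)] -/
theorem gap_core {s : ℕ} (M : Matrix (Fin s × Fin 9) (Fin s × Fin 9) K) (cvec rvec : Fin 5 → Fin 9)
    (hdet : (M.submatrix (fun p : Fin 5 × Fin s => (p.2, rvec p.1))
      (fun p : Fin 5 × Fin s => (p.2, cvec p.1))).det ≠ 0)
    (hC0supp : ∀ (k : Fin 5) (j j' : Fin s) (i : Fin 9), j' ≠ j → M (j', i) (j, cvec k) = 0)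
    (c : ℕ) (touch : Fin s × Fin 9 → Finset (Fin s)) (htouch : ∀ q, (touch q).card ≤ c)
    (hsupp : ∀ (p q : Fin s × Fin 9), p.1 ∉ touch q → M p q = 0) :
    ∃ J : Finset (Fin s), J.card ≤ c * (M.rank - 5 * s) ∧
      ∀ j, j ∉ J → ∀ q : Fin s × Fin 9,
        (fun i : Fin 9 => M (j, i) q) ∈
          Submodule.span K (Set.range fun k : Fin 5 => fun i : Fin 9 => M (j, i) (j, cvec k)) := by
  classical
  -- columns as vectors
  set col : Fin s × Fin 9 → (Fin s × Fin 9 → K) := fun q p => M p q with hcol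
  -- the selected columns are linearly independent
  have hli : LinearIndependent K (fun k : Fin 5 × Fin s => col (k.2, cvec k.1)) := by
    rw [Fintype.linearIndependent_iff]
    intro g hg
    have hmv : (M.submatrix (fun p : Fin 5 × Fin s => (p.2, rvec p.1))
        (fun p : Fin 5 × Fin s => (p.2, cvec p.1))) *ᵥ g = 0 := by
      funext p
      have := congrFun hg (p.2, rvec p.1)
      simp only [Finset.sum_apply, Pi.smul_apply, smul_eq_mul, Pi.zero_apply, hcol] at this
      rw [Matrix.mulVec, dotProduct]
      simp only [Matrix.submatrix_apply, Pi.zero_apply]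
      rw [← this]
      exact Finset.sum_congr rfl fun k _ => mul_comm _ _
    have := Matrix.eq_zero_of_mulVec_eq_zero hdet hmv
    exact fun k => congrFun this k
  set S0 : Set (Fin s × Fin 9 → K) := Set.range (fun k : Fin 5 × Fin s => col (k.2, cvec k.1))
    with hS0
  set T : Set (Fin s × Fin 9 → K) := Set.range col with hT
  have hS0T : S0 ⊆ T := by
    rintro _ ⟨k, rfl⟩; exact ⟨_, rfl⟩
  obtain ⟨b, hbT, hS0b, hTb, hbli⟩ := exists_linearIndepOn_id_extension hli.linearIndepOn_id hS0T
  have hbfin : b.Finite := (Set.finite_range col).subset hbT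
  have hS0fin : S0.Finite := Set.finite_range _
  -- cardinalities
  have hspan : Submodule.span K b = Submodule.span K T :=
    le_antisymm (Submodule.span_mono hbT) (Submodule.span_le.mpr hTb)
  have hcardb : hbfin.toFinset.card = M.rank := by
    letI : Fintype b := hbfin.fintype
    have h1 := finrank_span_set_eq_card (R := K) (s := b) hbli
    rw [Matrix.rank_eq_finrank_span_cols]
    have hT' : Set.range M.col = T := by
      ext v; simp only [hT, hcol, Set.mem_range]; rfl
    rw [hT', ← hspan, h1, Set.Finite.toFinset_eq_toFinset]
  have hcardS0 : hS0fin.toFinset.card = 5 * s := by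
    rw [Set.Finite.toFinset_range, Finset.card_image_of_injective _ hli.injective]
    simp [mul_comm]
  set D : Finset (Fin s × Fin 9 → K) := hbfin.toFinset \ hS0fin.toFinset with hD
  have hcardD : D.card = M.rank - 5 * s := by
    rw [hD, Finset.card_sdiff_of_subset, hcardb, hcardS0]
    intro v hv
    rw [Set.Finite.mem_toFinset] at hv ⊢
    exact hS0b hv
  -- the blocks met by the added columns
  set τ : (Fin s × Fin 9 → K) → Finset (Fin s) := fun v =>
    if h : ∃ q, col q = v then touch h.choose else ∅ with hτ
  have hτc : ∀ v, (τ v).card ≤ c := by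
    intro v
    simp only [hτ]
    split_ifs with h
    · exact htouch _
    · simp
  refine ⟨D.biUnion τ, ?_, ?_⟩
  · calc (D.biUnion τ).card ≤ ∑ v ∈ D, (τ v).card := Finset.card_biUnion_le
      _ ≤ ∑ _v ∈ D, c := Finset.sum_le_sum fun v _ => hτc v
      _ = c * (M.rank - 5 * s) := by rw [Finset.sum_const, smul_eq_mul, hcardD, mul_comm]
  · intro j hj q
    -- the segment map of block `j`
    set seg : (Fin s × Fin 9 → K) →ₗ[K] (Fin 9 → K) := LinearMap.funLeft K K fun i : Fin 9 => (j, i)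
      with hseg
    have hsegb : ∀ v ∈ b, seg v ∈
        Submodule.span K (Set.range fun k : Fin 5 => fun i : Fin 9 => M (j, i) (j, cvec k)) := by
      intro v hv
      by_cases hvS : v ∈ S0
      · obtain ⟨k, rfl⟩ := hvS
        by_cases hk : k.2 = j
        · refine Submodule.subset_span ⟨k.1, ?_⟩
          funext i
          simp [hseg, LinearMap.funLeft_apply, hcol, hk]
        · have : seg (col (k.2, cvec k.1)) = 0 := by
            funext i
            simp only [hseg, LinearMap.funLeft_apply, hcol, Pi.zero_apply]
            exact hC0supp k.1 k.2 j i (fun h' => hk h'.symm)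
          rw [this]; exact zero_mem _
      · have hvD : v ∈ D := by
          rw [hD, Finset.mem_sdiff, Set.Finite.mem_toFinset, Set.Finite.mem_toFinset]
          exact ⟨hv, hvS⟩
        have hjτ : j ∉ τ v := fun h => hj (Finset.mem_biUnion.mpr ⟨v, hvD, h⟩)
        have hex : ∃ q', col q' = v := by
          obtain ⟨q', hq'⟩ := hbT hv
          exact ⟨q', hq'⟩
        have hτv : τ v = touch hex.choose := by simp only [hτ, dif_pos hex]
        rw [hτv] at hjτ
        have : seg v = 0 := by
          funext i
          rw [← hex.choose_spec]
          simp only [hseg, LinearMap.funLeft_apply, hcol, Pi.zero_apply]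
          exact hsupp (j, i) _ hjτ
        rw [this]; exact zero_mem _
    have hmap : Submodule.map seg (Submodule.span K b) ≤
        Submodule.span K (Set.range fun k : Fin 5 => fun i : Fin 9 => M (j, i) (j, cvec k)) := by
      rw [Submodule.map_span, Submodule.span_le]
      rintro _ ⟨v, hv, rfl⟩
      exact hsegb v hv
    have hq : col q ∈ Submodule.span K b := hTb ⟨q, rfl⟩
    have hsegq : seg (col q) = fun i => M (j, i) q := by
      funext i; simp [hseg, LinearMap.funLeft_apply, hcol]
    rw [← hsegq]
    exact hmap (Submodule.mem_map_of_mem hq)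

/-- **The local block lemma** (the per-block content of Lemma 21 (2) / of t23's
`tphiCore_of_rank_le`, under the LOCAL hypothesis): if the block-`j` segment of every column of
`M` lies in the span of the block-`j` segments of the five selected columns of block `j`, then in
block `j` the local variables copy the actual ones (`u = x, v = y, w = z`) and
`(1−ℓ(u))(1−ℓ(v))(1−ℓ(w)) = 0`. Row-shape hypotheses as in `tphiCore_of_rank_le`.
[cite: BlaserIkenmeyerJindalLysikov2018, Lemma 21 (2), Lemma 22 (proof)] -/
theorem tphiCore_local {s : ℕ} (M : Matrix (Fin s × Fin 9) (Fin s × Fin 9) K)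
    (x uu d e g : Fin s → Fin 3 → K)
    (H1r : ∀ j a j' b, M (j, varRow a) (j', varRow b) = if (j', varRow b) = (j, varRow a) then 1 else 0)
    (H1c : ∀ j a j' b, M (j, varRow a) (j', clauseRow b) = 0)
    (H1' : ∀ j a, M (j, varRow a) (j, varCol a) = x j a)
    (H2 : ∀ j a q, M (j, varCol a) q = (if q = (j, varRow a) then 1 else 0) +
      (if q = (j, varCol a) then uu j a else 0) + (if q = (j, clauseRow a) then d j a else 0))
    (H30 : ∀ j q, M (j, clauseRow 0) q = (if q = (j, varCol 0) then e j 0 else 0) +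
      (if q = (j, clauseRow 0) then g j 0 else 0) + (if q = (j, clauseRow 1) then 1 else 0))
    (H31 : ∀ j q, M (j, clauseRow 1) q = (if q = (j, varCol 1) then e j 1 else 0) +
      (if q = (j, clauseRow 1) then g j 1 else 0) + (if q = (j, clauseRow 2) then 1 else 0))
    (H32 : ∀ j q, M (j, clauseRow 2) q = (if q = (j, varCol 2) then e j 2 else 0) +
      (if q = (j, clauseRow 2) then g j 2 else 0))
    (j : Fin s)
    (hloc : ∀ q : Fin s × Fin 9, (fun i : Fin 9 => M (j, i) q) ∈
      Submodule.span K (Set.range fun k : Fin 5 => fun i : Fin 9 =>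
        M (j, i) (j, (![varRow 0, varRow 1, varRow 2, clauseRow 2, clauseRow 1] : Fin 5 → Fin 9) k))) :
    (∀ a, uu j a = x j a) ∧ g j 0 * g j 1 * g j 2 = 0 := by
  classical
  -- coefficients of every column segment in the five selected segments
  have hex : ∀ q : Fin s × Fin 9, ∃ α : Fin 5 → K, ∀ i₉ : Fin 9, M (j, i₉) q =
      M (j, i₉) (j, varRow 0) * α 0 + M (j, i₉) (j, varRow 1) * α 1 +
        M (j, i₉) (j, varRow 2) * α 2 + M (j, i₉) (j, clauseRow 2) * α 3 +
        M (j, i₉) (j, clauseRow 1) * α 4 := by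
    intro q
    obtain ⟨α, hα⟩ := Submodule.mem_span_range_iff_exists_fun K |>.mp (hloc q)
    refine ⟨α, fun i₉ => ?_⟩
    have := congrFun hα i₉
    simp only [Finset.sum_apply, Pi.smul_apply, smul_eq_mul, Fin.sum_univ_five] at this
    rw [← this]
    simp only [Matrix.cons_val_zero, Matrix.cons_val_one, Matrix.head_cons, Matrix.cons_val_two,
      Matrix.tail_cons, Matrix.cons_val_three, Matrix.cons_val_four]
    ring
  choose α hsum using hex
  -- the rows of block `j`, read through `hsum`
  have rVR : ∀ (a : Fin 3) q, M (j, varRow a) q =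
      (if a = 0 then α q 0 else 0) + (if a = 1 then α q 1 else 0) +
        (if a = 2 then α q 2 else 0) := by
    intro a q; rw [hsum]; fin_cases a <;> simp +decide [H1r, H1c]
  have rVC : ∀ (a : Fin 3) q, M (j, varCol a) q =
      (if a = 0 then α q 0 else 0) + (if a = 1 then α q 1 + d j 1 * α q 4 else 0) +
        (if a = 2 then α q 2 + d j 2 * α q 3 else 0) := by
    intro a q; rw [hsum]; fin_cases a <;> simp +decide [H2]
  have rC0 : ∀ q, M (j, clauseRow 0) q = α q 4 := by
    intro q; rw [hsum]; simp +decide [H30]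
  have rC1 : ∀ q, M (j, clauseRow 1) q = α q 3 + g j 1 * α q 4 := by
    intro q; rw [hsum]; simp +decide [H31]
  have rC2 : ∀ q, M (j, clauseRow 2) q = g j 2 * α q 3 := by
    intro q; rw [hsum]; simp +decide [H32]
  have fin3 : ∀ a : Fin 3, a = 0 ∨ a = 1 ∨ a = 2 := by decide
  refine ⟨fun a => ?_, ?_⟩
  · have ha := rVR a (j, varCol a)
    rw [H1'] at ha
    have hb := rVC a (j, varCol a)
    rw [H2] at hb
    have hc := rC0 (j, varCol a)
    rw [H30] at hc
    have hd := rC1 (j, varCol a)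
    rw [H31] at hd
    rcases fin3 a with rfl | rfl | rfl
    · simp +decide at ha hb
      rw [hb, ha]
    · simp +decide at ha hb hc
      rw [hb, ha, ← hc]; ring
    · simp +decide at ha hb hc hd
      rw [← hc] at hd
      rw [hb, ha]
      have h3 : α (j, varCol 2) 3 = 0 := by linear_combination -hd
      rw [h3]; ring
  · have h0 := rC0 (j, clauseRow 0)
    rw [H30] at h0
    have h1 := rC1 (j, clauseRow 0)
    rw [H31] at h1
    have h2 := rC2 (j, clauseRow 0)
    rw [H32] at h2
    simp +decide only [Prod.mk.injEq, true_and, if_true, if_false, zero_add, add_zero]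
      at h0 h1 h2
    linear_combination (g j 1 * g j 2) * h0 - (g j 2) * h1 + h2

/-- Every local index is a variable row, a local-variable row or a clause row. [folklore] -/
private theorem fin9_trichotomy' (i : Fin 9) :
    (∃ a : Fin 3, i = varRow a) ∨ (∃ a : Fin 3, i = varCol a) ∨ (∃ a : Fin 3, i = clauseRow a) := by
  revert i; decide

/-- `varRow` is injective. [folklore] -/
private theorem varRow_inj' : ∀ a b : Fin 3, varRow a = varRow b → a = b := by decide

/-- `varCol` is injective. [folklore] -/
private theorem varCol_inj' : ∀ a b : Fin 3, varCol a = varCol b → a = b := by decide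

/-- **The gap bound, abstract form.** For a matrix with gadget-shaped blocks (hypotheses as in
`tphiCore_of_rank_le`) whose columns are each supported on at most `c` blocks, all but at most
`c · (rk M − 5s)` blocks satisfy `u = x, v = y, w = z` and `(1−ℓ(u))(1−ℓ(v))(1−ℓ(w)) = 0`.
[cite: BlaserIkenmeyerJindalLysikov2018, Lemma 22 (2) (repaired form)] -/
theorem gap_blocks {s : ℕ} (M : Matrix (Fin s × Fin 9) (Fin s × Fin 9) K)
    (x uu d e g : Fin s → Fin 3 → K)
    (H1r : ∀ j a j' b, M (j, varRow a) (j', varRow b) = if (j', varRow b) = (j, varRow a) then 1 else 0)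
    (H1c : ∀ j a j' b, M (j, varRow a) (j', clauseRow b) = 0)
    (H1' : ∀ j a, M (j, varRow a) (j, varCol a) = x j a)
    (H2 : ∀ j a q, M (j, varCol a) q = (if q = (j, varRow a) then 1 else 0) +
      (if q = (j, varCol a) then uu j a else 0) + (if q = (j, clauseRow a) then d j a else 0))
    (H30 : ∀ j q, M (j, clauseRow 0) q = (if q = (j, varCol 0) then e j 0 else 0) +
      (if q = (j, clauseRow 0) then g j 0 else 0) + (if q = (j, clauseRow 1) then 1 else 0))
    (H31 : ∀ j q, M (j, clauseRow 1) q = (if q = (j, varCol 1) then e j 1 else 0) +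
      (if q = (j, clauseRow 1) then g j 1 else 0) + (if q = (j, clauseRow 2) then 1 else 0))
    (H32 : ∀ j q, M (j, clauseRow 2) q = (if q = (j, varCol 2) then e j 2 else 0) +
      (if q = (j, clauseRow 2) then g j 2 else 0))
    (c : ℕ) (touch : Fin s × Fin 9 → Finset (Fin s)) (htouch : ∀ q, (touch q).card ≤ c)
    (hsupp : ∀ (p q : Fin s × Fin 9), p.1 ∉ touch q → M p q = 0) :
    ∃ J : Finset (Fin s), J.card ≤ c * (M.rank - 5 * s) ∧
      ∀ j, j ∉ J → (∀ a, uu j a = x j a) ∧ g j 0 * g j 1 * g j 2 = 0 := by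
  classical
  obtain ⟨hdet, -⟩ := tphiCore_five_mul_le_rank M uu d e g H2 H30 H31
  have hC0supp : ∀ (k : Fin 5) (j j' : Fin s) (i : Fin 9), j' ≠ j →
      M (j', i) (j, (![varRow 0, varRow 1, varRow 2, clauseRow 2, clauseRow 1] :
        Fin 5 → Fin 9) k) = 0 := by
    intro k j j' i₉ hj
    have hj' : j ≠ j' := fun h => hj h.symm
    rcases fin9_trichotomy' i₉ with ⟨a, rfl⟩ | ⟨a, rfl⟩ | ⟨a, rfl⟩
    · fin_cases k <;> simp [H1r, H1c, hj']
    · fin_cases k <;> simp [H2, hj']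
    · fin_cases a <;> fin_cases k <;> simp [H30, H31, H32, hj']
  obtain ⟨J, hJ, hloc⟩ := gap_core M _ _ (by rw [hdet]; exact one_ne_zero) hC0supp c touch htouch
    hsupp
  exact ⟨J, hJ, fun j hj => tphiCore_local M x uu d e g H1r H1c H1' H2 H30 H31 H32 j (hloc j hj)⟩

/-! ### Instantiation for the pencil of `T_φ` at an arbitrary point -/

variable {t : ℕ}

open Lemma22Safe in
/-- A variable row of block `j` meets the local column of a slot of another block only if that
slot's variable occurs in clause `j` (the coupling entries). [cite: BlaserIkenmeyerJindalLysikov2018, §5 (construction of `T_φ`)] -/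
theorem pencil_varRow_varCol_eq_zero_of_forall_ne (φ : List (Clause₃ t)) (c : SliceIdx φ → K)
    (j : Fin φ.length) (a : Fin 3) (j' : Fin φ.length) (b : Fin 3)
    (hx : ∀ a₀ : Fin 3, ((φ.get j).lit a₀).1 ≠ ((φ.get j').lit b).1) :
    pencilEval (tphiA₀ K φ) (tphiSlices K φ) c (j, varRow a) (j', varCol b) = 0 := by
  have hj : j ≠ j' := by
    rintro rfl; exact hx b rfl
  rw [pencilEval_apply, sloc_eq_zero_varRow]
  have hA : tphiA₀ K φ (j, varRow a) (j', varCol b) = 0 := by simp [tphiA₀, hj]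
  have hsv : (∑ x : Fin t, c (Sum.inl x) * tphiSlices K φ (Sum.inl x) (j, varRow a) (j', varCol b))
      = 0 := by
    have e := Lemma22.svar_apply (K := K) φ (fun x => c (Sum.inl x)) (j, varRow a) (j', varCol b)
    beta_reduce at e
    rw [e]
    refine Finset.sum_eq_zero fun a₁ _ => Finset.sum_eq_zero fun a₂ _ => ?_
    rw [if_neg]
    rintro ⟨-, h2, h3⟩
    have hb : a₂ = b := varCol_inj' _ _ h2.symm
    subst hb
    exact hx a₁ h3.symm
  have hsa : (∑ σ : (Σ x : Fin t, {pp : Occ φ x × Occ φ x // pp.1 ≠ pp.2}),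
      c (Sum.inr (Sum.inr σ)) * tphiSlices K φ (Sum.inr (Sum.inr σ)) (j, varRow a) (j', varCol b))
      = 0 := by
    refine Finset.sum_eq_zero fun σ _ => ?_
    rw [Lemma22.tphiSlices_aux_apply, if_neg, mul_zero]
    rintro ⟨h1, h2⟩
    simp only [Prod.mk.injEq] at h1 h2
    -- the two occurrences are of the same variable `σ.1`
    have hh := σ.2.1.1.2   -- var of h = σ.1
    have hl := σ.2.1.2.2   -- var of l = σ.1
    have ha : σ.2.1.1.1.2 = a := (varRow_inj' _ _ h1.2).symm
    have hb : σ.2.1.2.1.2 = b := (varCol_inj' _ _ h2.2).symm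
    apply hx a
    rw [h1.1, h2.1, ← ha, ← hb, hh, hl]
  rw [hA, hsv, hsa]
  simp

open Lemma22Safe in
/-- **The gap bound for the pencil of `T_φ`, at every point.** If every variable of `φ` occurs in
at most `c` clauses, then at every point the number of clauses not satisfied by the value (at its
own variable) of one of their literals is at most `c · (rk − 5s)`.
[cite: BlaserIkenmeyerJindalLysikov2018, Lemma 22 (2) (repaired form)] -/
theorem exists_blocks_of_rank (φ : List (Clause₃ t)) (cv : SliceIdx φ → K) (c : ℕ) (hc : 0 < c)
    (hocc : ∀ x : Fin t,
      (Finset.univ.filter fun j : Fin φ.length => ∃ a : Fin 3, ((φ.get j).lit a).1 = x).card ≤ c) :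
    ∃ J : Finset (Fin φ.length),
      J.card ≤ c * ((pencilEval (tphiA₀ K φ) (tphiSlices K φ) cv).rank - 5 * φ.length) ∧
      ∀ j, j ∉ J → ∃ a : Fin 3, SatisfiesLit K ((φ.get j).lit a).2 (cv (Sum.inl ((φ.get j).lit a).1)) := by
  classical
  set M := pencilEval (tphiA₀ K φ) (tphiSlices K φ) cv with hM
  -- the block support of the columns
  set touch : Fin φ.length × Fin 9 → Finset (Fin φ.length) := fun q =>
    Finset.univ.filter fun j => j = q.1 ∨
      ∃ b a : Fin 3, q.2 = varCol b ∧ ((φ.get j).lit a).1 = ((φ.get q.1).lit b).1 with htouch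
  have htc : ∀ q, (touch q).card ≤ c := by
    rintro ⟨j', i⟩
    by_cases hi : ∃ b, i = varCol b
    · obtain ⟨b, rfl⟩ := hi
      refine le_trans (Finset.card_le_card ?_) (hocc ((φ.get j').lit b).1)
      intro j hj
      simp only [htouch, Finset.mem_filter, Finset.mem_univ, true_and] at hj ⊢
      rcases hj with rfl | ⟨b', a, hb', h⟩
      · exact ⟨b, rfl⟩
      · have : b' = b := (varCol_inj' _ _ hb'.symm)
        subst this
        exact ⟨a, h⟩
    · have : touch (j', i) = {j'} := by
        ext j
        simp only [htouch, Finset.mem_filter, Finset.mem_univ, true_and, Finset.mem_singleton]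
        constructor
        · rintro (rfl | ⟨b, a, hb, -⟩)
          · rfl
          · exact absurd ⟨b, hb⟩ hi
        · intro h; exact Or.inl h
      rw [this, Finset.card_singleton]
      exact hc
  have hsupp : ∀ p q : Fin φ.length × Fin 9, p.1 ∉ touch q → M p q = 0 := by
    rintro ⟨j, i⟩ ⟨j', i'⟩ hp
    simp only [htouch, Finset.mem_filter, Finset.mem_univ, true_and, not_or, not_exists,
      not_and] at hp
    obtain ⟨hj, hno⟩ := hp
    by_cases hi : ∃ a, i = varRow a
    · obtain ⟨a, rfl⟩ := hi
      rcases fin9_trichotomy' i' with ⟨b, rfl⟩ | ⟨b, rfl⟩ | ⟨b, rfl⟩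
      · rw [hM, pencil_varRow_varRow]
        rw [if_neg]
        rintro h
        exact hj (congrArg Prod.fst h).symm
      · exact pencil_varRow_varCol_eq_zero_of_forall_ne φ cv j a j' b fun a₀ h => hno b a₀ rfl h
      · rw [hM, pencil_varRow_clauseRow]
    · push Not at hi
      exact pencil_offblock φ cv j j' i i' hj hi
  obtain ⟨J, hJ, hblk⟩ := gap_blocks M
    (fun j a => cv (Sum.inl ((φ.get j).lit a).1))
    (fun j a => cv (Sum.inr (Sum.inl (j, a, 0))))
    (fun j a => gs K ((φ.get j).lit a).2 (cv (Sum.inr (Sum.inl (j, a, 0)))) -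
      cv (Sum.inr (Sum.inl (j, a, 1))))
    (fun j a => cv (Sum.inr (Sum.inl (j, a, 0))) - cv (Sum.inr (Sum.inl (j, a, 2))))
    (fun j a => 1 - gl K ((φ.get j).lit a).2 (cv (Sum.inr (Sum.inl (j, a, 0)))))
    (pencil_varRow_varRow φ cv) (pencil_varRow_clauseRow φ cv) (pencil_varRow_varCol φ cv)
    (pencil_row_varCol φ cv) (pencil_row_clauseRow0 φ cv) (pencil_row_clauseRow1 φ cv)
    (pencil_row_clauseRow2 φ cv) c touch htc hsupp
  refine ⟨J, hJ, fun j hj => ?_⟩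
  obtain ⟨hux, hg⟩ := hblk j hj
  rw [hux 0, hux 1, hux 2] at hg
  rcases mul_eq_zero.1 hg with hg' | hg2
  · rcases mul_eq_zero.1 hg' with hg0 | hg1
    · exact ⟨0, Lemma21.satisfiesLit_of_sub_gl_eq_zero _ _ hg0⟩
    · exact ⟨1, Lemma21.satisfiesLit_of_sub_gl_eq_zero _ _ hg1⟩
  · exact ⟨2, Lemma21.satisfiesLit_of_sub_gl_eq_zero _ _ hg2⟩

/-- Counting satisfied clauses through the indices. [folklore] -/
private theorem countP_eq_card_filter {α : Type*} (P : α → Bool) :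
    ∀ l : List α, l.countP P =
      (Finset.univ.filter fun i : Fin l.length => P (l.get i) = true).card := by
  intro l
  induction l with
  | nil => simp
  | cons x xs ih =>
    rw [List.countP_cons, ih, Finset.card_filter, Finset.card_filter]
    rw [show (∑ i : Fin (x :: xs).length, (if P ((x :: xs).get i) = true then 1 else 0)) =
        ∑ i : Fin (xs.length + 1), (if P ((x :: xs).get i) = true then 1 else 0) from rfl,
      Fin.sum_univ_succ]
    simp only [List.get_cons_zero, show ∀ i : Fin xs.length, (x :: xs).get i.succ = xs.get i from
      fun i => rfl]
    split_ifs <;> omega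

open Lemma22Safe in
/-- **Boolean rounding after the gap bound.** At every point `cv`, the rounding
`σ(v) := [cv_v = 1]` satisfies all but at most `c · (rk − 5s)` clauses (occurrence bound `c`).
[cite: BlaserIkenmeyerJindalLysikov2018, Lemma 22 (2) (repaired form)] -/
theorem length_le_numSat₃_add (φ : List (Clause₃ t)) (cv : SliceIdx φ → K) (c : ℕ) (hc : 0 < c)
    (hocc : ∀ x : Fin t,
      (Finset.univ.filter fun j : Fin φ.length => ∃ a : Fin 3, ((φ.get j).lit a).1 = x).card ≤ c) :
    ∃ σ : Fin t → Bool, φ.length ≤ numSat₃ φ σ +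
      c * ((pencilEval (tphiA₀ K φ) (tphiSlices K φ) cv).rank - 5 * φ.length) := by
  classical
  obtain ⟨J, hJ, hsat⟩ := exists_blocks_of_rank φ cv c hc hocc
  refine ⟨fun v => decide (cv (Sum.inl v) = 1), ?_⟩
  have hσ : ∀ v, (fun v => decide (cv (Sum.inl v) = 1)) v = true ↔ cv (Sum.inl v) = 1 :=
    fun v => decide_eq_true_iff
  -- every clause outside `J` is satisfied
  have hgood : ∀ j : Fin φ.length, j ∉ J →
      (((φ.get j).1.eval fun v => decide (cv (Sum.inl v) = 1)) ||
        ((φ.get j).2.1.eval fun v => decide (cv (Sum.inl v) = 1)) ||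
        ((φ.get j).2.2.eval fun v => decide (cv (Sum.inl v) = 1))) = true := by
    intro j hj
    obtain ⟨a, ha⟩ := hsat j hj
    have hlit := eval_of_satisfiesLit φ cv _ hσ _ ha
    have h0 : (φ.get j).lit 0 = (φ.get j).1 := by simp [Clause₃.lit]
    have h1 : (φ.get j).lit 1 = (φ.get j).2.1 := by simp [Clause₃.lit]
    have h2 : (φ.get j).lit 2 = (φ.get j).2.2 := by simp [Clause₃.lit]
    simp only [Bool.or_eq_true]
    have fin3 : a = 0 ∨ a = 1 ∨ a = 2 := by
      rcases a with ⟨_ | _ | _ | n, h⟩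
      · exact Or.inl rfl
      · exact Or.inr (Or.inl rfl)
      · exact Or.inr (Or.inr rfl)
      · omega
    rcases fin3 with rfl | rfl | rfl
    · exact Or.inl (Or.inl (h0 ▸ hlit))
    · exact Or.inl (Or.inr (h1 ▸ hlit))
    · exact Or.inr (h2 ▸ hlit)
  -- count
  unfold numSat₃
  rw [countP_eq_card_filter]
  have hsub : Finset.univ \ J ⊆ Finset.univ.filter fun i : Fin φ.length =>
      (((φ.get i).1.eval fun v => decide (cv (Sum.inl v) = 1)) ||
        ((φ.get i).2.1.eval fun v => decide (cv (Sum.inl v) = 1)) ||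
        ((φ.get i).2.2.eval fun v => decide (cv (Sum.inl v) = 1))) = true := by
    intro j hj
    rw [Finset.mem_sdiff] at hj
    exact Finset.mem_filter.mpr ⟨Finset.mem_univ _, hgood j hj.2⟩
  have h1 := Finset.card_le_card hsub
  have h2 : (Finset.univ \ J).card = φ.length - J.card := by
    rw [Finset.card_sdiff_of_subset (Finset.subset_univ J), Finset.card_univ, Fintype.card_fin]
  have h3 : J.card ≤ φ.length := by
    simpa using Finset.card_le_univ J
  omega

open Lemma22Safe in
variable (K) in
/-- **BIJL 2018 Lemma 22 (2), REPAIRED (the bounded-occurrence gap).** If every variable of the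
3-CNF `φ` occurs in at most `c ≥ 1` clauses and every Boolean assignment satisfies at most
`(1 − ε) s` clauses, then `CR(T_φ) ≥ (5 + ε / c) · s`.  (The printed statement has `ε` in place of
`ε / c` and is false for general 3-CNF — `not_BIJL2018_lemma22`; under the promise of Thm. 20's
source problem, bounded occurrence `c`, this repaired gap still yields a constant-factor gap for
`CR`, hence Thm. 23's route through Thm. 18 with a worse constant.)  Proof: at a minimising point,
extend the `5s` unitriangular columns to a basis of the column space by columns; each column meets
at most `c` blocks, so at most `c · (CR − 5s)` blocks are met by the added columns; every other block
has all its column segments in the span of its own five selected segments, which forces a literal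
of that clause to be satisfied by the actual value of its variable (`Lemma22Gap.tphiCore_local`);
round `σ(v) := [c_v = 1]`.
[cite: BlaserIkenmeyerJindalLysikov2018, Lemma 22 (2) (repaired statement; erratum)] -/
theorem completionRank_tphi_gap (φ : List (Clause₃ t)) (c : ℕ) (hc : 0 < c)
    (hocc : ∀ x : Fin t,
      (Finset.univ.filter fun j : Fin φ.length => ∃ a : Fin 3, ((φ.get j).lit a).1 = x).card ≤ c)
    (ε : ℚ) (hgap : ∀ σ : Fin t → Bool, (numSat₃ φ σ : ℚ) ≤ (1 - ε) * φ.length) :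
    (5 + ε / c) * φ.length ≤ (completionRank (tphiA₀ K φ) (tphiSlices K φ) : ℚ) := by
  obtain ⟨cv, hcv⟩ := exists_rank_pencilEval_eq_completionRank (tphiA₀ K φ) (tphiSlices K φ)
  have h5 : 5 * φ.length ≤ completionRank (tphiA₀ K φ) (tphiSlices K φ) :=
    five_mul_length_le_completionRank_tphi K φ
  obtain ⟨σ, hσ⟩ := length_le_numSat₃_add φ cv c hc hocc
  rw [hcv] at hσ
  have hσQ : (φ.length : ℚ) ≤ (numSat₃ φ σ : ℚ) +
      (c : ℚ) * ((completionRank (tphiA₀ K φ) (tphiSlices K φ) : ℚ) - 5 * (φ.length : ℚ)) := by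
    have := (Nat.cast_le (α := ℚ)).mpr hσ
    push_cast [Nat.cast_sub h5] at this
    linarith
  have hg := hgap σ
  have hc' : (0 : ℚ) < c := by exact_mod_cast hc
  have key : ε * (φ.length : ℚ) ≤
      (c : ℚ) * ((completionRank (tphiA₀ K φ) (tphiSlices K φ) : ℚ) - 5 * (φ.length : ℚ)) := by
    linarith
  have key' : ε / c * (φ.length : ℚ) ≤
      (completionRank (tphiA₀ K φ) (tphiSlices K φ) : ℚ) - 5 * (φ.length : ℚ) := by
    rw [div_mul_eq_mul_div, div_le_iff₀ hc']
    linarith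
  linarith

end Lemma22Gap

open Lemma22Gap Lemma22Safe

variable {t : ℕ}

variable (K) in
/-- **The combinatorial form of the repaired Lemma 22 (2):** if every variable occurs in at most
`c ≥ 1` clauses, some Boolean assignment satisfies at least `s − c · (CR(T_φ) − 5s)` clauses.
[cite: BlaserIkenmeyerJindalLysikov2018, Lemma 22 (2) (repaired statement; erratum)] -/
theorem exists_length_le_numSat₃_add_completionRank (φ : List (Clause₃ t)) (c : ℕ) (hc : 0 < c)
    (hocc : ∀ x : Fin t,
      (Finset.univ.filter fun j : Fin φ.length => ∃ a : Fin 3, ((φ.get j).lit a).1 = x).card ≤ c) :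
    ∃ σ : Fin t → Bool, φ.length ≤ numSat₃ φ σ +
      c * (completionRank (tphiA₀ K φ) (tphiSlices K φ) - 5 * φ.length) := by
  obtain ⟨cv, hcv⟩ := exists_rank_pencilEval_eq_completionRank (tphiA₀ K φ) (tphiSlices K φ)
  obtain ⟨σ, hσ⟩ := length_le_numSat₃_add φ cv c hc hocc
  exact ⟨σ, by rwa [hcv] at hσ⟩

variable (K) in
/-- **BIJL 2018 Lemma 22 (2), REPAIRED — the bounded-occurrence gap.** If every variable of the
3-CNF `φ` occurs in at most `c ≥ 1` clauses and every Boolean assignment satisfies at most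
`(1 − ε) s` clauses, then `CR(T_φ) ≥ (5 + ε / c) · s`. [cite: BlaserIkenmeyerJindalLysikov2018, Lemma 22 (2) (repaired statement; erratum)] -/
theorem BIJL2018_lemma22_gap (φ : List (Clause₃ t)) (c : ℕ) (hc : 0 < c)
    (hocc : ∀ x : Fin t,
      (Finset.univ.filter fun j : Fin φ.length => ∃ a : Fin 3, ((φ.get j).lit a).1 = x).card ≤ c)
    (ε : ℚ) (hgap : ∀ σ : Fin t → Bool, (numSat₃ φ σ : ℚ) ≤ (1 - ε) * φ.length) :
    (5 + ε / c) * φ.length ≤ (completionRank (tphiA₀ K φ) (tphiSlices K φ) : ℚ) :=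
  completionRank_tphi_gap K φ c hc hocc ε hgap

variable (K) in
/-- **Tightness of the repaired gap** on the refuting example of `not_BIJL2018_lemma22`:
`φ₄ = [x∨x∨x, x∨x∨x, ¬x∨¬x∨¬x, ¬x∨¬x∨¬x]` (`t = 1`, `s = 4`, every variable in `c = 4` clauses,
`ε = 1/2`) has `CR(T_{φ₄}) = 21 = 5s + t` exactly: `≤ 21` by `completionRank_tphi_le`, `≥ 20.5` by
`BIJL2018_lemma22_gap`. [cite: BlaserIkenmeyerJindalLysikov2018, Lemma 22 (2) (repaired statement; erratum)] -/
theorem completionRank_tphi_phi4 :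
    completionRank
        (tphiA₀ K ([((0, true), (0, true), (0, true)), ((0, true), (0, true), (0, true)),
          ((0, false), (0, false), (0, false)), ((0, false), (0, false), (0, false))] :
            List (Clause₃ 1)))
        (tphiSlices K ([((0, true), (0, true), (0, true)), ((0, true), (0, true), (0, true)),
          ((0, false), (0, false), (0, false)), ((0, false), (0, false), (0, false))] :
            List (Clause₃ 1))) = 21 := by
  set φ₄ : List (Clause₃ 1) :=
    [((0, true), (0, true), (0, true)), ((0, true), (0, true), (0, true)),
     ((0, false), (0, false), (0, false)), ((0, false), (0, false), (0, false))] with hφ₄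
  have hlen : φ₄.length = 4 := by simp [hφ₄]
  have hup : completionRank (tphiA₀ K φ₄) (tphiSlices K φ₄) ≤ 21 := by
    have h := completionRank_tphi_le (K := K) φ₄
    have h' : 5 * φ₄.length + 1 = 21 := by rw [hlen]
    omega
  have hocc : ∀ x : Fin 1,
      (Finset.univ.filter fun j : Fin φ₄.length => ∃ a : Fin 3, ((φ₄.get j).lit a).1 = x).card ≤ 4 :=
    fun x => (Finset.card_filter_le _ _).trans (by simp [hlen])
  have hgap : ∀ σ : Fin 1 → Bool, (numSat₃ φ₄ σ : ℚ) ≤ (1 - 1 / 2) * φ₄.length := by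
    intro σ
    have hval : numSat₃ φ₄ σ = 2 := by
      cases hσ : σ 0 <;> simp [numSat₃, hφ₄, Literature.Computability.Complexity.Literal.eval, hσ]
    have hlenQ : ((φ₄.length : ℕ) : ℚ) = 4 := by exact_mod_cast hlen
    rw [hval, hlenQ]
    norm_num
  have hlow := BIJL2018_lemma22_gap K φ₄ 4 (by norm_num) hocc (1 / 2) hgap
  have hlenQ : ((φ₄.length : ℕ) : ℚ) = 4 := by exact_mod_cast hlen
  rw [hlenQ] at hlow
  have h21 : (21 : ℚ) ≤ (completionRank (tphiA₀ K φ₄) (tphiSlices K φ₄) : ℚ) := by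
    have h : (41 / 2 : ℚ) ≤ (completionRank (tphiA₀ K φ₄) (tphiSlices K φ₄) : ℚ) := by
      have : (5 + 1 / 2 / (4 : ℕ)) * (4 : ℚ) = 41 / 2 := by norm_num
      linarith [hlow, this]
    have hint : (20 : ℚ) < (completionRank (tphiA₀ K φ₄) (tphiSlices K φ₄) : ℚ) := by linarith
    have : 20 < completionRank (tphiA₀ K φ₄) (tphiSlices K φ₄) := by exact_mod_cast hint
    exact_mod_cast this
  have h21' : 21 ≤ completionRank (tphiA₀ K φ₄) (tphiSlices K φ₄) := by exact_mod_cast h21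
  omega

end Literature.Barriers.ValiantsHypothesis

end
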